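import Summits.CriticalPhenomena.SAWScalingLimit.Theorems.SAWRenewalTightnessEventualTightSketchDefs

/-!
# X2 — the `ℤ²` VIRGIN-DISC form of the atom S3′ of the line `Sketch` (crux `EventualTight`, stmt-CriticalPhenomena-1372)

Typed PROPOSAL (lead c1, 2026-08-16; companion of `Cruxes/EventualTight/LeadAnalysis-c1.md` §2(c), §3, §5):
the only architecture whose atoms survive both the corridor obstruction (sup-over-past statements are false as
typed / crux-sized when boundary-attached, LeadAnalysis A1–A2) and the connector deficit (fixed-resolution
surgery, LeadAnalysis Proposition B) is VIRGIN-REGION CONDITIONING, as in the hex line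
`Cruxes/HexTight/Lines/reversal-virgin-disc.lean` (stmt-5423).  This file TYPES its `ℤ²` transposition for the
reshaped atom `CleanMultiShadowDecay` (tree: `Theorems/SAWRenewalTightnessEventualTightSketchDefs.lean` §C,
`Theorems.cleanMultiShadowDecay_iff_eventualTight`), so that a planner can line it and the disprover can attack
the sup-over-exteriors statement `VirginArcCleanShadowDecay` (the lead's `disprover-wanted` target) before
anybody builds the glue.  NOTHING here is asserted: statements are `def … : Prop`; the only theorem is the
trivial interior/boundary case split.

Objects (lattice units; vertices `Site 2`, nearest-neighbour graph `zdGraph 2`, embedding `Site.toComplex`):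
* a CONFIGURATION is a graph `H ≤ zdGraph 2` with an allowed vertex set `Λ` (in the application
  `H = discreteDomainGraph Ω δ` minus the vertices of the SAW's prefix before its first entrance into the closed
  lattice disc `B̄(z₀, N)` and of its suffix after the last exit; `Λ` = the remaining vertices);
* `IsVirgin H Λ z₀ N`: the open lattice disc of radius `N` lies in `Λ` and every lattice edge of the closed
  `(N+1)`-disc is an `H`-edge — nothing is assumed outside the disc (holes, floating pasts, dropped edges allowed);
* `IsDoor Λ z₀ N u c`: a lattice edge from `u ∉ Λ` outside the circle to `c ∈ Λ` inside (first-entrance /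
  last-exit edges);
* `Arc H Λ c c'`: self-avoiding `H`-walks from `c` to `c'` inside `Λ`; `arcMass` = their `x_c`-mass,
  `cleanShadowMass` = the `x_c`-mass of those whose polyline has `j` clean, co-oriented, pairwise `η`-shadowing
  separate traversal strands of the shell `D(z₀; n, R)` (`HasCleanShadowingFamily` of the tree, §C).

Statements:
* `VirginArcCleanShadowDecay` (X2, the atom; sup over exteriors; mesh-free; numerically testable): for every
  aspect `A > 2`, resolution `η > 0` and `θ > 0` there are `j`, `N₀` such that for every virgin configuration of
  radius `N ≥ N₀` and every pair of doors, `cleanShadowMass(j; n = N/A, R = N/2, ηN) ≤ θ · arcMass`.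
* `InteriorAtom` / `BoundaryAtom`: the tree atom `CleanMultiShadowDecay` restricted to shells with
  `closedBall x (2R + 1) ⊆ Ω` (room for a virgin disc of Euclidean radius `2R` plus a collar at every mesh `δ ≤ 1`)
  resp. the other shells; `cleanMultiShadowDecay_of_interior_of_boundary` recombines them (proved).
* `Virginization := VirginArcCleanShadowDecay → InteriorAtom` — the exact glue to be BUILT by the next line
  (statement only).  Intended proof, all exact: fix `(D, a, b)`, an interior shell `(x, r, R)`, `θ`; lattice
  centre `z₀ := x/δ`, radius `N := 2R/δ`, aspect `A := 2R/r > 2`, so that `D(x; r, R) = δ · D(z₀; N/A, N/2)`;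
  for `δ` small the endpoints `a_δ, b_δ` lie outside `B̄(x, 2R + δ)` (endpoint limits + `a, b ∈ ∂Ω`); cut
  every SAW at its first entrance into / last exit from the closed lattice disc `B̄(z₀, N)` (doors `(u, c)`,
  `(u', c')`); conditionally on prefix and suffix the middle piece is `x_c`-distributed on `Arc H Λ c c'` with
  `(H, Λ)` virgin at `(z₀, N)` (the disc `δ·B̄(z₀, N+1) ⊆ Ω` is untouched by prefix/suffix) — two-sided domain
  Markov property of `P ∝ x_c^{#edges}`, an identity of finite sums; the clean strands of the shell live in
  `B̄(x, R) = δ·B̄(z₀, N/2)`, inside the middle piece, and `HasCleanShadowingFamily` is covariant under the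
  similarity `z ↦ δ z` and under restriction to the middle piece's parameter window; sum the X2 inequality
  (with `η` fixed, say `η := 1/8`, and the `j, N₀` it provides) over (prefix, suffix); meshes with `N < N₀`,
  i.e. `δ > 2R/N₀`, are finitely many lattice scales at which the event is EMPTY once `j` exceeds the number of
  lattice points of `B̄(x, r)` (a SAW visits each once; `Theorems.stub_travCount`-type cutoff).
* What X2 does NOT cover: `BoundaryAtom` (shells meeting the collar of `∂Ω`) — unreduced, exactly as
  `stub_boundaryShells` on hex; it is a verbatim piece of the crux.

Calibration: X2 is NOT implied by the crux (uniform over arbitrary finite exteriors), so it CAN be false while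
the crux is true — the first thing to test (LeadAnalysis `disprover-wanted`): can an exterior acting only through
the two doors force `j` clean co-oriented shadowing inner-shell strands inside a virgin disc?  On hex the
analogous one-arm statement survived this test (`Cruxes/HexTight/DrefuteSurvived.md`: forcing gadgets cost extra
rim-to-rim strands); the multi-strand version was not attacked there either.
-/

noncomputable section

open MeasureTheory Filter Topology Set Metric
open scoped ENNReal NNReal unitInterval
open Literature.Probability.RandomPlanarGeometry Literature.Probability.LatticeModels
open Summit.CriticalPhenomena.SAWScalingLimit.Theorems.EventualTight.Sketch
  (HasCleanShadowingFamily CleanMultiShadowDecay)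

namespace Summit.CriticalPhenomena.SAWScalingLimit.Cruxes.EventualTight.X2

/-! ## Objects -/

/-- **Virgin configuration** at `(z₀, N)` (lattice units): `H` is a subgraph of `ℤ²`, every lattice point of
the open `N`-disc about `z₀` is allowed, and every lattice edge between points of the closed `(N+1)`-disc is an
edge of `H`.  Nothing is assumed outside the disc. -/
structure IsVirgin (H : SimpleGraph (Site 2)) (Λ : Finset (Site 2)) (z₀ : ℂ) (N : ℝ) : Prop where
  /-- `H` is a subgraph of the nearest-neighbour graph of `ℤ²` -/
  le : H ≤ zdGraph 2
  /-- every lattice point of the open `N`-disc is allowed -/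
  mem : ∀ v : Site 2, dist (Site.toComplex v) z₀ < N → v ∈ Λ
  /-- every lattice edge of the closed `(N+1)`-disc is an `H`-edge -/
  adj : ∀ v v' : Site 2, dist (Site.toComplex v) z₀ ≤ N + 1 → dist (Site.toComplex v') z₀ ≤ N + 1 →
    (zdGraph 2).Adj v v' → H.Adj v v'

/-- **Door** on the circle of radius `N`: a lattice edge from `u ∉ Λ` strictly outside the circle to `c ∈ Λ`
in the closed disc (the first-entrance / last-exit edge of the cut). -/
def IsDoor (Λ : Finset (Site 2)) (z₀ : ℂ) (N : ℝ) (u c : Site 2) : Prop :=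
  (zdGraph 2).Adj u c ∧ u ∉ Λ ∧ c ∈ Λ ∧ dist (Site.toComplex c) z₀ ≤ N ∧ N < dist (Site.toComplex u) z₀

/-- **Arcs**: self-avoiding `H`-walks from `c` to `c'` all of whose vertices are allowed. (A finite type when
`Λ` is finite and `H ≤ zdGraph 2`; the masses below are `tsum`s, equal to the finite sums.) -/
def Arc (H : SimpleGraph (Site 2)) (Λ : Finset (Site 2)) (c c' : Site 2) : Type :=
  {p : H.Walk c c' // p.IsPath ∧ ∀ v ∈ p.support, v ∈ Λ}

/-- The polyline of a walk, in lattice units. -/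
def arcCurve {H : SimpleGraph (Site 2)} {c c' : Site 2} (p : H.Walk c c') : Curve ℂ :=
  ⟨p.toCurve Site.toComplex⟩

/-- `x_c`-mass of the arcs `c → c'`. -/
def arcMass (H : SimpleGraph (Site 2)) (Λ : Finset (Site 2)) (c c' : Site 2) : ℝ :=
  ∑' p : Arc H Λ c c', SAW.criticalFugacity ^ p.1.length

open Classical in
/-- `x_c`-mass of the arcs `c → c'` whose polyline has `j` CLEAN, CO-ORIENTED, pairwise `η`-shadowing separate
traversal strands of the shell `D(z₀; n, R)` (the tree's `HasCleanShadowingFamily`, lattice units). -/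
def cleanShadowMass (H : SimpleGraph (Site 2)) (Λ : Finset (Site 2)) (c c' : Site 2) (j : ℕ) (z₀ : ℂ)
    (n R η : ℝ) : ℝ :=
  ∑' p : Arc H Λ c c',
    if HasCleanShadowingFamily (arcCurve p.1) j z₀ n R η then SAW.criticalFugacity ^ p.1.length else 0

/-! ## Statements (none asserted) -/

/-- **X2 `VirginArcCleanShadowDecay`** — the `ℤ²` virgin-disc form of the atom S3′: for every aspect `A > 2`,
resolution `η > 0` and `θ > 0` there are a strand number `j` and a radius `N₀` such that, uniformly over virgin
configurations of radius `N ≥ N₀` (ARBITRARY exterior) and over pairs of doors, the arcs carrying `j` clean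
co-oriented pairwise `ηN`-shadowing traversal strands of `D(z₀; N/A, N/2)` have `x_c`-mass at most `θ ·` (arc
mass).  Mesh-free; rate-free; numerically testable; NOT implied by the crux. -/
def VirginArcCleanShadowDecay : Prop :=
  ∀ A : ℝ, 2 < A → ∀ η : ℝ, 0 < η → ∀ θ : ℝ, 0 < θ → ∃ (j : ℕ) (N₀ : ℝ), 0 < N₀ ∧
    ∀ (H : SimpleGraph (Site 2)) (Λ : Finset (Site 2)) (z₀ : ℂ) (N : ℝ) (u c u' c' : Site 2),
      N₀ ≤ N → IsVirgin H Λ z₀ N → IsDoor Λ z₀ N u c → IsDoor Λ z₀ N u' c' →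
      cleanShadowMass H Λ c c' j z₀ (N / A) (N / 2) (η * N) ≤ θ * arcMass H Λ c c'

/-- The tree atom `CleanMultiShadowDecay` restricted to the shells selected by `good D x R`. -/
def CleanMultiShadowDecayOn (good : DobrushinDomain → ℂ → ℝ → Prop) : Prop :=
  ∀ (D : DobrushinDomain) (a b : ℝ → Site 2), SAW.IsEndpointApprox D a b →
    ∀ (x : ℂ) (r R : ℝ), 0 < r → r < R → good D x R → ∀ θ : ℝ, 0 < θ →
      ∃ η : ℝ, 0 < η ∧ ∃ (j : ℕ) (δ₁ : ℝ), 0 < δ₁ ∧ ∀ δ ∈ Set.Ioc (0 : ℝ) δ₁,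
        SAW.law D.carrier δ (a δ) (b δ)
          {γ | HasCleanShadowingFamily (⟨γ.walk.toCurve (meshPoint δ)⟩ : Curve ℂ) j x r R η}
          ≤ ENNReal.ofReal θ

/-- **Interior shells**: room for a virgin disc of Euclidean radius `2R` plus a unit collar inside `Ω`. -/
def InteriorAtom : Prop :=
  CleanMultiShadowDecayOn fun D x R => Metric.closedBall x (2 * R + 1) ⊆ D.carrier

/-- **Boundary shells** (NOT reduced by X2; a verbatim piece of the crux, as `stub_boundaryShells` on hex). -/
def BoundaryAtom : Prop :=
  CleanMultiShadowDecayOn fun D x R => ¬ Metric.closedBall x (2 * R + 1) ⊆ D.carrier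

/-- **Virginization** (the exact glue the next line would build; statement only — see the module docstring for
the intended proof by first-entrance / last-exit cutting and the two-sided domain Markov identity). -/
def Virginization : Prop := VirginArcCleanShadowDecay → InteriorAtom

/-- Interior and boundary shells together give the tree atom back (case split). [folklore] -/
theorem cleanMultiShadowDecay_of_interior_of_boundary (hI : InteriorAtom) (hB : BoundaryAtom) :
    CleanMultiShadowDecay := by
  intro D a b hab x r R hr hrR θ hθ
  by_cases h : Metric.closedBall x (2 * R + 1) ⊆ D.carrier
  · exact hI D a b hab x r R hr hrR h θ hθ
  · exact hB D a b hab x r R hr hrR h θ hθ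

/-- **The proposed next skeleton, as a statement**: X2 + its glue + the boundary atom give the tree atom, hence
(`Theorems.cleanMultiShadowDecay_iff_eventualTight`) the crux. [folklore] -/
theorem cleanMultiShadowDecay_of_X2 (hX2 : VirginArcCleanShadowDecay) (hV : Virginization) (hB : BoundaryAtom) :
    CleanMultiShadowDecay :=
  cleanMultiShadowDecay_of_interior_of_boundary (hV hX2) hB

end Summit.CriticalPhenomena.SAWScalingLimit.Cruxes.EventualTight.X2

end
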